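import Summits.CriticalPhenomena.PercolationContinuityZ3.Theorems.PercNearOneGluingNoHeavyLowerTailIncStarRootPairConcaveForest
import Summits.CriticalPhenomena.PercolationContinuityZ3.Theorems.PercNearOneGluingNoHeavyLowerTailIncStarBridgeChordThreePoint
import HarnessLib

/-!
# THEOREM FC: on an apex-forest, `E₃` of the increasing star lies above its chord along EVERY pair

Support file for the Sahi programme (`--supports stmt-CriticalPhenomena-4575`, prover prim-sahi-p2 gen 20).  No definitions, no named
facts, no sorries; standard axioms.  Memo `run/shared/lean/prim/prim-sahi/prim-sahi-p2/PROOF-E3.md` §30; CONJECTURE FC of p2 gen 18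
(memo `FROM-prim-sahi-p2-gen18-REVELATION-CALCULUS-FOREST-CONCAVITY.md` §1), lead g120 §8 (FC assembly (a)–(e)).

**Setting.**  `prodBernoulli w` on the pairs of `Fin n`, root `s`, targets `a, b, c` (arbitrary: coincident, at the root, anywhere),
`E₃ = sahiE3 P_w {s↔a} {s↔b} {s↔c}`.  For a pair `e` let `H₁(w, e) = fromEdgeSet {z | s ∉ z ∧ w[e↦1] z ≠ 0}` be the environment with `e`
forced in (for a root pair this is just the environment `H(w)`).  HYPOTHESIS: `H₁(w, e)` is acyclic — `w` is an apex-forest weight and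
stays one when `e` is switched on.

* `incStar_envBridge_threePoint_of_apexForest` — **FC case (d), three-point form**: along an environment pair `e = s(u,v)` whose `u`-side
  (the component of `u` in `H₁ − e`) holds no target, `q ↦ E₃(w[e↦q])` is CONCAVE on `[0,1]`.  Proof: the `u`-side together with `e` is a
  two-terminal blob between `s` and `v`; the blob reparametrisation `IncStar.incStar_blob_transfer` turns the pencil along `e` into the
  pencil along the root pair `s(s,v)` of the reduced apex-forest over a sub-interval, where `IncStar.incStar_rootPair_concave_of_apexForest`
  (part II) applies; `IncStar.threePoint_transfer_real` transfers.
* `incStar_pair_threePoint_of_apexForest` — **THEOREM FC (concavity along EVERY pair, three-point form)**: for every non-diagonal pair `e`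
  with `H₁(w, e)` acyclic, all targets and `0 ≤ p₀ ≤ p ≤ p₁ ≤ 1`, `(p₁ − p)·E₃(w[e↦p₀]) + (p − p₀)·E₃(w[e↦p₁]) ≤ (p₁ − p₀)·E₃(w[e↦p])`.
  Cases: a target at the root — `Cov` (`incStar_rootSlot_threePoint`); root pair — part II; environment pair separating the targets 1|2 —
  THEOREM B in three-point form (`IncStar.incStar_bridge_threePoint`, near side = the side with one target, or its mirror); 0|3 — the
  previous theorem (from the target-free side).
* `incStar_pair_chord_of_apexForest` — the chord form `(1 − w e)·E₃(w[e↦0]) + (w e)·E₃(w[e↦1]) ≤ E₃(w)` (case `(0, w e, 1)`).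
Consequently (lead g120 §8 (j)) every chord step of the revelation calculus on an apex-forest is nonnegative.
-/

noncomputable section

namespace Summit.CriticalPhenomena.PercolationContinuityZ3.Theorems

namespace IncStar

open MeasureTheory Set Literature.Probability.Percolation Literature.Probability.LatticeModels
open scoped Classical

variable {n : ℕ}

/-- Switching a pair on does not shrink the environment. [folklore] -/
theorem envGraph_le_update_one (w : Sym2 (Fin n) → unitInterval) (s : Fin n) (e : Sym2 (Fin n)) :
    SimpleGraph.fromEdgeSet {z : Sym2 (Fin n) | s ∉ z ∧ w z ≠ 0}
      ≤ SimpleGraph.fromEdgeSet {z : Sym2 (Fin n) | s ∉ z ∧ Function.update w e 1 z ≠ 0} := by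
  intro x y hxy
  rw [SimpleGraph.fromEdgeSet_adj] at hxy ⊢
  obtain ⟨⟨hs, hw⟩, hne⟩ := hxy
  refine ⟨⟨hs, ?_⟩, hne⟩
  by_cases h : s(x, y) = e
  · rw [h, Function.update_self]; exact one_ne_zero
  · rwa [Function.update_of_ne h]

/-- **FC case (d): concavity along a 0|3 environment bridge (three-point form).**  Let `u, v ≠ s`, `u ≠ v`, let the environment with
`e = s(u,v)` switched on be acyclic, and let no target be reachable from `u` in that environment minus `e`.  Then for `0 ≤ p₀ ≤ p ≤ p₁ ≤ 1`,
`(p₁ − p)·E₃(w[e↦p₀]) + (p − p₀)·E₃(w[e↦p₁]) ≤ (p₁ − p₀)·E₃(w[e↦p])`. [this work] -/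
theorem incStar_envBridge_threePoint_of_apexForest (w : Sym2 (Fin n) → unitInterval) {s u v a b c : Fin n}
    (hus : u ≠ s) (hvs : v ≠ s) (huv : u ≠ v)
    (hforest : (SimpleGraph.fromEdgeSet {z : Sym2 (Fin n) | s ∉ z ∧ Function.update w s(u, v) 1 z ≠ 0}).IsAcyclic)
    (ha : ¬ ((SimpleGraph.fromEdgeSet {z : Sym2 (Fin n) | s ∉ z ∧ Function.update w s(u, v) 1 z ≠ 0}).deleteEdges
      {s(u, v)}).Reachable u a)
    (hb : ¬ ((SimpleGraph.fromEdgeSet {z : Sym2 (Fin n) | s ∉ z ∧ Function.update w s(u, v) 1 z ≠ 0}).deleteEdges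
      {s(u, v)}).Reachable u b)
    (hc : ¬ ((SimpleGraph.fromEdgeSet {z : Sym2 (Fin n) | s ∉ z ∧ Function.update w s(u, v) 1 z ≠ 0}).deleteEdges
      {s(u, v)}).Reachable u c)
    (p₀ p p₁ : unitInterval) (h01 : p₀ ≤ p) (h12 : p ≤ p₁) :
    ((p₁ : ℝ) - (p : ℝ)) * sahiE3 (prodBernoulli (Function.update w s(u, v) p₀)) (openConn s a) (openConn s b) (openConn s c)
      + ((p : ℝ) - (p₀ : ℝ)) * sahiE3 (prodBernoulli (Function.update w s(u, v) p₁)) (openConn s a) (openConn s b) (openConn s c)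
    ≤ ((p₁ : ℝ) - (p₀ : ℝ)) * sahiE3 (prodBernoulli (Function.update w s(u, v) p)) (openConn s a) (openConn s b) (openConn s c) := by
  have h01' : (p₀ : ℝ) ≤ p := h01
  have h12' : (p : ℝ) ≤ p₁ := h12
  set w1 := Function.update w s(u, v) 1 with hw1
  set H := SimpleGraph.fromEdgeSet {z : Sym2 (Fin n) | s ∉ z ∧ w1 z ≠ 0} with hH
  -- the `u`-side of the bridge
  set B : Finset (Fin n) := Finset.univ.filter fun z => (H.deleteEdges {s(u, v)}).Reachable u z with hB
  have memB : ∀ z : Fin n, z ∈ B ↔ (H.deleteEdges {s(u, v)}).Reachable u z := fun z => by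
    rw [hB, Finset.mem_filter]
    exact ⟨fun h => h.2, fun h => ⟨Finset.mem_univ _, h⟩⟩
  have hadj : H.Adj u v := by
    rw [hH, SimpleGraph.fromEdgeSet_adj]
    refine ⟨⟨fun hmem => ?_, ?_⟩, huv⟩
    · rcases Sym2.mem_iff.1 hmem with h | h
      · exact hus h.symm
      · exact hvs h.symm
    · rw [hw1, Function.update_self]; exact one_ne_zero
  have hsB : s ∉ B := fun h => apexForest_root_not_mem w1 hus {s(u, v)} ((memB s).1 h)
  have hvB : v ∉ B := fun h =>
    SimpleGraph.isBridge_iff.1 (SimpleGraph.isAcyclic_iff_forall_adj_isBridge.1 hforest hadj) ((memB v).1 h)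
  have huB : u ∈ B := (memB u).2 (SimpleGraph.Reachable.refl u)
  have haB : a ∉ B := fun h => ha ((memB a).1 h)
  have hbB : b ∉ B := fun h => hb ((memB b).1 h)
  have hcB : c ∉ B := fun h => hc ((memB c).1 h)
  have hwB : ∀ x' ∈ B, ∀ z, z ∉ B → z ≠ s → z ≠ v → w s(x', z) = 0 := by
    intro x' hx' z hzB hzs hzv
    have hx : (H.deleteEdges {s(u, v)}).Reachable u x' := (memB x').1 hx'
    have hz : ¬ (H.deleteEdges {s(u, v)}).Reachable u z := fun h => hzB ((memB z).2 h)
    have hne : s(x', z) ≠ s(u, v) := by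
      intro h
      rw [Sym2.eq_iff] at h
      rcases h with ⟨-, h2⟩ | ⟨h1, -⟩
      · exact hzv h2
      · exact hvB (h1 ▸ hx')
    have h0 := apexForest_cross w1 hus {s(u, v)} hx hz hzs (by rwa [Set.mem_singleton_iff])
    rwa [hw1, Function.update_of_ne hne] at h0
  -- blob reparametrisation: the pencil along `e` is the pencil along the root pair at `v` of the reduced weight
  obtain ⟨θ₀, θ₁, hθ, hq⟩ := incStar_blob_transfer w B hsB hvB hvs.symm huB (Or.inr rfl) hwB haB hbB hcB
  obtain ⟨r₀, hr₀, E0⟩ := hq p₀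
  obtain ⟨r, hr, E⟩ := hq p
  obtain ⟨r₁, hr₁, E1⟩ := hq p₁
  rw [E0, E, E1]
  set W : Sym2 (Fin n) → unitInterval := fun z => if (∃ x' ∈ B, x' ∈ z) then 0 else w z with hW
  have hWapp : ∀ z : Sym2 (Fin n), W z = if (∃ x' ∈ B, x' ∈ z) then 0 else w z := fun z => by rw [hW]
  have hWz : ∀ z : Sym2 (Fin n), W z ≠ 0 → w z ≠ 0 := by
    intro z hz
    by_cases h : ∃ x' ∈ B, x' ∈ z
    · rw [hWapp z, if_pos h] at hz
      exact absurd rfl hz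
    · rwa [hWapp z, if_neg h] at hz
  have hforestW : (SimpleGraph.fromEdgeSet {z : Sym2 (Fin n) | s ∉ z ∧ W z ≠ 0}).IsAcyclic := by
    refine (hforest.anti (envGraph_le_update_one w s s(u, v))).anti fun x y hxy => ?_
    rw [SimpleGraph.fromEdgeSet_adj] at hxy ⊢
    exact ⟨⟨hxy.1.1, hWz _ hxy.1.2⟩, hxy.2⟩
  -- order of the new abscissae, and the root-pair concavity of part II
  have hk : 0 ≤ θ₁ - θ₀ := sub_nonneg.2 hθ
  have h01r : r₀ ≤ r := by
    have h1 : (0 : ℝ) ≤ ((p : ℝ) - p₀) * (θ₁ - θ₀) := mul_nonneg (sub_nonneg.2 h01') hk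
    have h2 : (r₀ : ℝ) ≤ r := by rw [hr₀, hr]; linarith
    exact_mod_cast h2
  have h12r : r ≤ r₁ := by
    have h1 : (0 : ℝ) ≤ ((p₁ : ℝ) - p) * (θ₁ - θ₀) := mul_nonneg (sub_nonneg.2 h12') hk
    have h2 : (r : ℝ) ≤ r₁ := by rw [hr, hr₁]; linarith
    exact_mod_cast h2
  have key := incStar_rootPair_concave_of_apexForest W s v a b c hvs hforestW r₀ r r₁ h01r h12r
  have e0 : (r₀ : ℝ) = θ₀ + (p₀ : ℝ) * (θ₁ - θ₀) := by rw [hr₀]; ring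
  have e : (r : ℝ) = θ₀ + (p : ℝ) * (θ₁ - θ₀) := by rw [hr]; ring
  have e1 : (r₁ : ℝ) = θ₀ + (p₁ : ℝ) * (θ₁ - θ₀) := by rw [hr₁]; ring
  refine threePoint_transfer_real (θ := θ₀) hk ?_ fun hk0 => ?_
  · rw [← e0, ← e, ← e1]
    exact key
  · have hθ' : θ₁ = θ₀ := by linarith
    have h1 : r₀ = r := Subtype.ext (by rw [hr₀, hr, hθ']; ring)
    have h2 : r₁ = r := Subtype.ext (by rw [hr₁, hr, hθ']; ring)
    rw [h1, h2]
    exact ⟨rfl, rfl⟩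

/-- **THEOREM FC (concavity form): on an apex-forest, `E₃` of the increasing star is concave along every pair** (three-point form).  For
every non-diagonal pair `e` such that the environment with `e` switched on is acyclic, all targets, and `0 ≤ p₀ ≤ p ≤ p₁ ≤ 1`,
`(p₁ − p)·E₃(w[e↦p₀]) + (p − p₀)·E₃(w[e↦p₁]) ≤ (p₁ − p₀)·E₃(w[e↦p])`. [this work] -/
theorem incStar_pair_threePoint_of_apexForest (w : Sym2 (Fin n) → unitInterval) (s a b c : Fin n) (e : Sym2 (Fin n))
    (he : ¬ e.IsDiag)
    (hforest : (SimpleGraph.fromEdgeSet {z : Sym2 (Fin n) | s ∉ z ∧ Function.update w e 1 z ≠ 0}).IsAcyclic)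
    (p₀ p p₁ : unitInterval) (h01 : p₀ ≤ p) (h12 : p ≤ p₁) :
    ((p₁ : ℝ) - (p : ℝ)) * sahiE3 (prodBernoulli (Function.update w e p₀)) (openConn s a) (openConn s b) (openConn s c)
      + ((p : ℝ) - (p₀ : ℝ)) * sahiE3 (prodBernoulli (Function.update w e p₁)) (openConn s a) (openConn s b) (openConn s c)
    ≤ ((p₁ : ℝ) - (p₀ : ℝ)) * sahiE3 (prodBernoulli (Function.update w e p)) (openConn s a) (openConn s b) (openConn s c) := by
  -- TARGETS AT THE ROOT: `E₃ = Cov` of the other two, concave along every pair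
  by_cases has : a = s
  · subst has
    exact incStar_rootSlot_threePoint w e a b c p₀ p p₁ h01 h12
  by_cases hbs : b = s
  · subst hbs
    have h := incStar_rootSlot_threePoint w e b a c p₀ p p₁ h01 h12
    simp only [sahiE3_comm₁₂ _ (openConn b b) (openConn b a) (openConn b c)] at h
    exact h
  by_cases hcs : c = s
  · subst hcs
    have h := incStar_rootSlot_threePoint w e c a b p₀ p p₁ h01 h12
    simp only [sahiE3_comm₁₂ _ (openConn c c) (openConn c a) (openConn c b),
      sahiE3_comm₂₃ _ (openConn c a) (openConn c c) (openConn c b)] at h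
    exact h
  -- a representative of the pair
  induction e using Sym2.ind with
  | h u v =>
  have huv : u ≠ v := fun h => he (Sym2.mk_isDiag_iff.2 h)
  -- ROOT PAIRS: part II
  by_cases hus : u = s
  · subst hus
    have hvu : v ≠ u := fun h => huv h.symm
    have hf : (SimpleGraph.fromEdgeSet {z : Sym2 (Fin n) | u ∉ z ∧ w z ≠ 0}).IsAcyclic :=
      hforest.anti (envGraph_le_update_one w u _)
    exact incStar_rootPair_concave_of_apexForest w u v a b c hvu hf p₀ p p₁ h01 h12
  by_cases hvs : v = s
  · subst hvs
    have hf : (SimpleGraph.fromEdgeSet {z : Sym2 (Fin n) | v ∉ z ∧ w z ≠ 0}).IsAcyclic :=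
      hforest.anti (envGraph_le_update_one w v _)
    have h := incStar_rootPair_concave_of_apexForest w v u a b c hus hf p₀ p p₁ h01 h12
    rw [Sym2.eq_swap (a := v) (b := u)] at h
    exact h
  -- ENVIRONMENT PAIRS: the `u`-side `L` of the bridge and its mirror `M`
  set w1 := Function.update w s(u, v) 1 with hw1
  set H := SimpleGraph.fromEdgeSet {z : Sym2 (Fin n) | s ∉ z ∧ w1 z ≠ 0} with hH
  have hadj : H.Adj u v := by
    rw [hH, SimpleGraph.fromEdgeSet_adj]
    refine ⟨⟨fun hmem => ?_, ?_⟩, huv⟩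
    · rcases Sym2.mem_iff.1 hmem with h | h
      · exact hus h.symm
      · exact hvs h.symm
    · rw [hw1, Function.update_self]; exact one_ne_zero
  have hbridge : ¬ (H.deleteEdges {s(u, v)}).Reachable u v :=
    SimpleGraph.isBridge_iff.1 (SimpleGraph.isAcyclic_iff_forall_adj_isBridge.1 hforest hadj)
  set L : Set (Fin n) := {t | (H.deleteEdges {s(u, v)}).Reachable u t} with hL
  have hsL : s ∉ L := apexForest_root_not_mem w1 hus _
  have huL : u ∈ L := SimpleGraph.Reachable.refl u
  have hvL : v ∉ L := hbridge
  have hcross : ∀ x y : Fin n, x ∈ L → y ∉ L → y ≠ s → s(x, y) ≠ s(u, v) → w s(x, y) = 0 := by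
    intro x y hx hy hys hne
    have h0 := apexForest_cross w1 hus {s(u, v)} hx hy hys (by rwa [Set.mem_singleton_iff])
    rwa [hw1, Function.update_of_ne hne] at h0
  set M : Set (Fin n) := {t | t ∉ L ∧ t ≠ s} with hM
  have hsM : s ∉ M := fun h => h.2 rfl
  have hvM : v ∈ M := ⟨hvL, hvs⟩
  have huM : u ∉ M := fun h => h.1 huL
  have hcrossM : ∀ x y : Fin n, x ∈ M → y ∉ M → y ≠ s → s(x, y) ≠ s(v, u) → w s(x, y) = 0 := by
    intro x y hx hy hys hne
    have hyL : y ∈ L := by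
      by_contra h
      exact hy ⟨h, hys⟩
    rw [Sym2.eq_swap]
    exact hcross y x hyL hx.1 hx.2 fun h => hne (Sym2.eq_swap.trans (h.trans Sym2.eq_swap))
  have nM : ∀ {t : Fin n}, t ∈ L → t ∉ M := fun ht h => h.1 ht
  -- THEOREM B (three-point form) for the near side `L` and for the mirror side `M`, along `s(u, v)`
  have nearB : ∀ a' b' c' : Fin n, a' ∈ L → b' ∉ L → c' ∉ L →
      ((p₁ : ℝ) - (p : ℝ)) * sahiE3 (prodBernoulli (Function.update w s(u, v) p₀)) (openConn s a') (openConn s b') (openConn s c')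
        + ((p : ℝ) - (p₀ : ℝ)) * sahiE3 (prodBernoulli (Function.update w s(u, v) p₁)) (openConn s a') (openConn s b') (openConn s c')
      ≤ ((p₁ : ℝ) - (p₀ : ℝ)) * sahiE3 (prodBernoulli (Function.update w s(u, v) p)) (openConn s a') (openConn s b') (openConn s c') :=
    fun a' b' c' ha' hb' hc' => incStar_bridge_threePoint w L hsL huL hvL ha' hb' hc' hcross p₀ p p₁ h01 h12
  have mirrorB : ∀ a' b' c' : Fin n, a' ∈ M → b' ∉ M → c' ∉ M →
      ((p₁ : ℝ) - (p : ℝ)) * sahiE3 (prodBernoulli (Function.update w s(u, v) p₀)) (openConn s a') (openConn s b') (openConn s c')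
        + ((p : ℝ) - (p₀ : ℝ)) * sahiE3 (prodBernoulli (Function.update w s(u, v) p₁)) (openConn s a') (openConn s b') (openConn s c')
      ≤ ((p₁ : ℝ) - (p₀ : ℝ)) * sahiE3 (prodBernoulli (Function.update w s(u, v) p)) (openConn s a') (openConn s b') (openConn s c') := by
    intro a' b' c' ha' hb' hc'
    have h := incStar_bridge_threePoint w M hsM hvM huM ha' hb' hc' hcrossM p₀ p p₁ h01 h12
    rw [Sym2.eq_swap (a := v) (b := u)] at h
    exact h
  -- slot permutations
  have permB : ((p₁ : ℝ) - (p : ℝ)) * sahiE3 (prodBernoulli (Function.update w s(u, v) p₀)) (openConn s b) (openConn s a) (openConn s c)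
        + ((p : ℝ) - (p₀ : ℝ)) * sahiE3 (prodBernoulli (Function.update w s(u, v) p₁)) (openConn s b) (openConn s a) (openConn s c)
      ≤ ((p₁ : ℝ) - (p₀ : ℝ)) * sahiE3 (prodBernoulli (Function.update w s(u, v) p)) (openConn s b) (openConn s a) (openConn s c) →
      ((p₁ : ℝ) - (p : ℝ)) * sahiE3 (prodBernoulli (Function.update w s(u, v) p₀)) (openConn s a) (openConn s b) (openConn s c)
        + ((p : ℝ) - (p₀ : ℝ)) * sahiE3 (prodBernoulli (Function.update w s(u, v) p₁)) (openConn s a) (openConn s b) (openConn s c)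
      ≤ ((p₁ : ℝ) - (p₀ : ℝ)) * sahiE3 (prodBernoulli (Function.update w s(u, v) p)) (openConn s a) (openConn s b) (openConn s c) := fun h => by
    simp only [sahiE3_comm₁₂ _ (openConn s b) (openConn s a) (openConn s c)] at h
    exact h
  have permC : ((p₁ : ℝ) - (p : ℝ)) * sahiE3 (prodBernoulli (Function.update w s(u, v) p₀)) (openConn s c) (openConn s a) (openConn s b)
        + ((p : ℝ) - (p₀ : ℝ)) * sahiE3 (prodBernoulli (Function.update w s(u, v) p₁)) (openConn s c) (openConn s a) (openConn s b)
      ≤ ((p₁ : ℝ) - (p₀ : ℝ)) * sahiE3 (prodBernoulli (Function.update w s(u, v) p)) (openConn s c) (openConn s a) (openConn s b) →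
      ((p₁ : ℝ) - (p : ℝ)) * sahiE3 (prodBernoulli (Function.update w s(u, v) p₀)) (openConn s a) (openConn s b) (openConn s c)
        + ((p : ℝ) - (p₀ : ℝ)) * sahiE3 (prodBernoulli (Function.update w s(u, v) p₁)) (openConn s a) (openConn s b) (openConn s c)
      ≤ ((p₁ : ℝ) - (p₀ : ℝ)) * sahiE3 (prodBernoulli (Function.update w s(u, v) p)) (openConn s a) (openConn s b) (openConn s c) := fun h => by
    simp only [sahiE3_comm₁₂ _ (openConn s c) (openConn s a) (openConn s b),
      sahiE3_comm₂₃ _ (openConn s a) (openConn s c) (openConn s b)] at h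
    exact h
  -- no target on the far side if all three are on the near side
  have farv : ∀ {t : Fin n}, t ∈ L → ¬ (H.deleteEdges {s(u, v)}).Reachable v t :=
    fun ht h => hbridge (SimpleGraph.Reachable.trans ht h.symm)
  by_cases haL : a ∈ L <;> by_cases hbL : b ∈ L <;> by_cases hcL : c ∈ L
  · -- 3|0: concavity from the target-free `v`-side
    have hf' : (SimpleGraph.fromEdgeSet {z : Sym2 (Fin n) | s ∉ z ∧ Function.update w s(v, u) 1 z ≠ 0}).IsAcyclic := by
      rw [Sym2.eq_swap (a := v) (b := u)]; exact hforest
    have h := incStar_envBridge_threePoint_of_apexForest w hvs hus huv.symm hf'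
      (by rw [Sym2.eq_swap (a := v) (b := u)]; exact farv haL) (by rw [Sym2.eq_swap (a := v) (b := u)]; exact farv hbL)
      (by rw [Sym2.eq_swap (a := v) (b := u)]; exact farv hcL) p₀ p p₁ h01 h12
    rw [Sym2.eq_swap (a := v) (b := u)] at h
    exact h
  · -- `a, b` near, `c` far: THEOREM B for the mirror side (single target `c`)
    exact permC (mirrorB c a b ⟨hcL, hcs⟩ (nM haL) (nM hbL))
  · exact permB (mirrorB b a c ⟨hbL, hbs⟩ (nM haL) (nM hcL))
  · -- `a` alone near: THEOREM B
    exact nearB a b c haL hbL hcL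
  · exact mirrorB a b c ⟨haL, has⟩ (nM hbL) (nM hcL)
  · exact permB (nearB b a c hbL haL hcL)
  · exact permC (nearB c a b hcL haL hbL)
  · -- 0|3: concavity from the target-free `u`-side
    exact incStar_envBridge_threePoint_of_apexForest w hus hvs huv hforest haL hbL hcL p₀ p p₁ h01 h12

/-- **THEOREM FC (chord form): on an apex-forest, `E₃` of the increasing star lies above its chord along every pair.**  For every
non-diagonal pair `e` such that the environment with `e` switched on is acyclic, and all targets,
`(1 − w e)·E₃(w[e↦0]) + (w e)·E₃(w[e↦1]) ≤ E₃(w)` (the case `(0, w e, 1)` of `incStar_pair_threePoint_of_apexForest`). [this work] -/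
theorem incStar_pair_chord_of_apexForest (w : Sym2 (Fin n) → unitInterval) (s a b c : Fin n) (e : Sym2 (Fin n))
    (he : ¬ e.IsDiag)
    (hforest : (SimpleGraph.fromEdgeSet {z : Sym2 (Fin n) | s ∉ z ∧ Function.update w e 1 z ≠ 0}).IsAcyclic) :
    (1 - (w e : ℝ)) * sahiE3 (prodBernoulli (Function.update w e 0)) (openConn s a) (openConn s b) (openConn s c)
      + (w e : ℝ) * sahiE3 (prodBernoulli (Function.update w e 1)) (openConn s a) (openConn s b) (openConn s c)
    ≤ sahiE3 (prodBernoulli w) (openConn s a) (openConn s b) (openConn s c) := by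
  have h := incStar_pair_threePoint_of_apexForest w s a b c e he hforest 0 (w e) 1 bot_le le_top
  rw [Function.update_eq_self] at h
  simpa using h

end IncStar

end Summit.CriticalPhenomena.PercolationContinuityZ3.Theorems
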